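import Summits.QuantumAdvantage.QuantumAdvantage.Theses.SpinorFlattening
import Literature.Computability.QuantumComplexity.GaussianRank

/-!
# Disproof file for the crux `SpinorFlattening.GaussRankTwoCopies` (stmt-QuantumAdvantage-1248)

Standing adversary (cdisprove): generation 1 (refuter-cdisprove-stmt-QuantumAdvantage-1248-0, §§0–5, §9 cycle 1),
generation 2 (refuter-cdisprove-stmt-QuantumAdvantage-1248-g2-0, §6–§7, §9 cycle 2). Prose lives in docstrings only.

THE CRUX. `χ_G(M ⊗ M) ≥ 4`: for all `a : Fin 3 → ℂ` and all triples `g` of (pure, fermionic,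
either-parity) Gaussian states on `2 * 4 = 8` qubits, `|M⟩^{⊗2} ≠ Σ_{i<3} a_i g_i`
(Cudby–Strelchuk 2023, §6.2, CONJECTURE; flattenings certify only `≥ 3`).

VERDICT SO FAR: see §9 (attack ledger) — updated at every boundary.

## Findings (index)
* §0 `crux_iff` — the crux is DEFINITIONALLY `TwoCopiesBound IsGaussian 3` over the landed
  vocabulary of `GaussianRank.lean` (`IsGaussian`, `magicMPow`).
* §1 LOAD-BEARING: `false_without_gaussianity` (drop the dictionary predicate: false with ONE term),
  `false_without_linearIndependence` (drop `LinearIndependent` inside the dictionary: every nonzero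
  vector qualifies, false with one term).
* §2 TIGHTNESS: `not_twoCopiesBound_four` — four Gaussian (Fock) terms DO reach `M ⊗ M`
  (`χ_G(M⊗M) ≤ 4`), so the constant `3` of the crux cannot be raised.
* §3 METRIC REFORMULATION / NATURAL STRENGTHENING (could NOT be refuted): `DistBound r c` :=
  every `r`-term Gaussian combination is at `normSq`-distance `≥ c` from `M ⊗ M`;
  `crux_of_distBound` : `DistBound 3 c → 0 < c → GaussRankTwoCopies`; `distBound_zero`,
  `not_distBound_four_pos` (exact endpoints). NUMERICAL FINDING (this seat, node.js local search
  `js/gsearch.js`, all 20 cut-type strata, 4 284 Levenberg–Marquardt restarts (18 rounds); kit jobs j008152 /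
  j008157 queued for the numpy twin): the best 3-term residual is ALWAYS `0.2500…` (never below
  `1/4`), the best 2-term residual `0.500…`, the best 1-term residual `0.750` = `1 - F_G(M)^2`:
  conjecturally `dist²(M⊗M, σ_r(Gaussians)) = 1 - r/4` for `r ≤ 4`, attained only by `r` Fock
  corners `½|c⁴d⁴⟩`. So the crux appears to hold ROBUSTLY (border rank 4, constant gap 1/4),
  far beyond what the K = 2 flattening certifies (gap ≥ 1/120 for r = 2, nothing for r = 3).
* §4 STRUCTURE any kill must have (docstring of `CutTypes`): all three terms even; the six
  Spin(8)×Spin(8)-orbits (cut types p = 4,3,2,1,0e,0o); even⊗even / odd⊗odd sector equations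
  `Σ aᵢ Eᵢ = m ⊗ m`, `Σ aᵢ Oᵢ = 0`; E(type 4) = conformal-ORTHOGONAL maps of (Δ₊(8), β), lower
  types = their isotropic degenerations; DEAD strata proved by hand here: (4,4,0e) (parity twin),
  (4,4,0o) (the DETERMINANT obstruction: `a·1 + b·R = rank 1 non-null` forces `R` = a hyperplane
  reflection, `det R = -1 ∉ SO`), (3,3,0e) (Levi `SL₄ × ℂ*` of the isotropic-line parabolic forces
  E₂ ∥ E₁), (2,2,0e), (2,2,0o) (isotropic planes cannot carry the non-null `m`), and no type-4 term
  can sit with two terms of total E-rank < 7. Live strata: (4,4,4), (4,4,3), (4,4,2), (4,4,1),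
  (4,3,3), (3,3,3), (3,3,2), (3,3,1), (3,2,2), (2,2,2), (2,2,1), (3,3,0o) — each a problem about
  ≤ 3 isoclinic rotations `R + R⁻¹ = κ·1 + (rank ≤ 2)` of (ℂ⁸, β); see §4.
* §5 REFUTED NATURAL STRENGTHENING (multiplicativity): `Parity.gaussianRank_not_multiplicative`
  — `|+⟩` is not Gaussian but `|++⟩` is a sum of two Gaussians; parity of `M` is load-bearing.
* §6 (cycle 2) ANNIHILATORS: `Annihilator.majorana_mulVec_basisState` (JW Majoranas flip one bit),
  `magicMPow_two_annihilator_eq_zero` / `magicM_annihilator_eq_zero` (TRIVIAL ANNIHILATOR — input (T1) of every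
  paper proof, kernel-checked), `magicMPow_two_not_isGaussian`, `magicM_not_isGaussian`, and the SHARP dictionary
  threshold: 4 annihilating rows ⇒ 2 terms suffice (`gaussRankTwoCopies_false_with_four_annihilators`), 1 term never
  (`gaussRankTwoCopies_oneTerm_free`), 5–7 rows implied by the crux (docstring), ≥ 9 rows vacuous
  (`no_nine_annihilating_rows`), plus ANNIHILATOR MAXIMALITY for Gaussian states (`annihilates_iff_mem_span_rows`).
  LANDED def-free: `Theorems/GaussRankTwoCopies/Negative/Annihilators.lean` (p78896); `…/AnnihilatorRows.lean` filed next.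
* §7 (cycle 2) TARGETS: pre-emptive audit of the candidate first lemmas of all lines (no stub false or mis-typed;
  where §6 plugs in).
* LANDED (gate-accepted, importable): `Summits.QuantumAdvantage.QuantumAdvantage.Theorems.GaussRankTwoCopies.
  Negative.TightFour` (p74629, commit 9f2a7d92c1b8) — `gaussRankTwoCopies_tight_four`,
  `gaussRankTwoCopies_false_without_gaussianity`, `gaussRankTwoCopies_false_without_linearIndependence`,
  `Parity.gaussianRank_not_multiplicative` (+ helpers `Parity.sum_qreg_one/two`, `Parity.majorana_*_apply`,
  `Parity.bell_isGaussian`, `card_filter_blockConst`), theorems only, axioms {propext, Classical.choice, Quot.sound}.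
* §9 ATTACK LEDGER (end of file).
-/

noncomputable section

set_option linter.dupNamespace false

namespace Summit.QuantumAdvantage.QuantumAdvantage.Cruxes.GaussRankTwoCopies.Disproof

open Literature.Computability.Cryptography Literature.Computability.QuantumComplexity Matrix
open Summit.QuantumAdvantage.QuantumAdvantage.Theses.SpinorFlattening (GaussRankTwoCopies)

/-! ## §0 The crux as an instance of a rank-bound schema -/

/-- `TwoCopiesBound P r`: no linear combination of `r` states from the dictionary `P` equals
`|M⟩^{⊗ 2}` (i.e. the `P`-rank of `M ⊗ M` exceeds `r`). The crux is `TwoCopiesBound IsGaussian 3`. -/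
def TwoCopiesBound (P : (QReg (2 * 4) → ℂ) → Prop) (r : ℕ) : Prop :=
  ∀ (a : Fin r → ℂ) (g : Fin r → QReg (2 * 4) → ℂ), (∀ i, P (g i)) → magicMPow 2 ≠ ∑ i, a i • g i

/-- The crux is, by `Iff.rfl`, the schema at the landed dictionary `IsGaussian` and `r = 3`
(the route's inline `maj`/`IsGauss`/`Mpow` unfold to `majorana`/`IsGaussian`/`magicMPow`). -/
theorem crux_iff : GaussRankTwoCopies ↔ TwoCopiesBound IsGaussian 3 := Iff.rfl

/-- Monotonicity of the schema in the dictionary: shrinking the dictionary preserves the bound. -/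
theorem TwoCopiesBound.mono {P P' : (QReg (2 * 4) → ℂ) → Prop} {r : ℕ} (hPP' : ∀ ψ, P' ψ → P ψ)
    (h : TwoCopiesBound P r) : TwoCopiesBound P' r :=
  fun a g hg => h a g fun i => hPP' _ (hg i)

/-! ## §1 Load-bearing hypotheses -/

/-- `|M⟩^{⊗2}` is a nonzero vector (amplitude `1/2` at the all-`false` string). -/
theorem sqrt_two_ne_zero : (Real.sqrt 2 : ℂ) ≠ 0 :=
  Complex.ofReal_ne_zero.mpr (Real.sqrt_ne_zero'.mpr (by norm_num))

theorem magicMPow_two_ne_zero : magicMPow 2 ≠ 0 := by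
  intro h
  have h0 := congrFun h (fun _ => false)
  rw [magicMPow_apply, if_pos (fun k i => rfl), Pi.zero_apply] at h0
  exact pow_ne_zero _ (inv_ne_zero sqrt_two_ne_zero) h0

/-- LOAD-BEARING (the dictionary predicate itself): with the Gaussianity requirement dropped
(dictionary = all nonzero vectors) the bound fails already with ONE term — any proof must use the
Gaussian structure of every term. -/
theorem false_without_gaussianity : ¬ TwoCopiesBound (fun ψ => ψ ≠ 0) 1 := by
  intro h
  refine h (fun _ => 1) (fun _ => magicMPow 2) (fun _ => magicMPow_two_ne_zero) ?_
  simp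

/-- LOAD-BEARING (`LinearIndependent` inside the dictionary): if the `n` annihilating combinations
are not required to be linearly independent, `A = 0` annihilates everything, every nonzero vector is
in the dictionary, and the bound fails with one term. -/
theorem false_without_linearIndependence :
    ¬ TwoCopiesBound (fun ψ => ψ ≠ 0 ∧ ∃ A : Fin (2 * 4) → (Fin (2 * 4) × Bool → ℂ),
        ∀ k, (∑ p : Fin (2 * 4) × Bool, A k p • majorana (2 * 4) p.1 p.2) *ᵥ ψ = 0) 1 := by
  intro h
  refine h (fun _ => 1) (fun _ => magicMPow 2) (fun _ => ⟨magicMPow_two_ne_zero, fun _ _ => 0, ?_⟩) ?_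
  · intro k
    simp
  · simp

/-! ## §2 Tightness: four Gaussian terms suffice -/

/-- The four block-constant bit strings on `2 * 4` wires: block `0` (wires `0..3`) carries
`i % 2`, block `1` (wires `4..7`) carries `i / 2`. -/
def blockString (i : Fin 4) : QReg (2 * 4) :=
  fun w => if w.val < 4 then decide (i.val % 2 = 1) else decide (i.val / 2 = 1)

/-- Counting form of `|M⟩^{⊗2} = ½ Σ_i |blockString i⟩`: a string is block-constant iff it is one
of the four `blockString i`, and then exactly one. -/
theorem card_filter_blockString_vec (b₀ b₁ b₂ b₃ b₄ b₅ b₆ b₇ : Bool) :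
    (Finset.univ.filter (fun i : Fin 4 =>
        (fun w : Fin (2 * 4) => ![b₀, b₁, b₂, b₃, b₄, b₅, b₆, b₇] w) = blockString i)).card =
      if (∀ k : Fin 2, ∀ i : Fin 4, (fun w : Fin (2 * 4) => ![b₀, b₁, b₂, b₃, b₄, b₅, b₆, b₇] w)
          (finProdFinEquiv (k, i)) =
        (fun w : Fin (2 * 4) => ![b₀, b₁, b₂, b₃, b₄, b₅, b₆, b₇] w) (finProdFinEquiv (k, (0 : Fin 4))))
      then 1 else 0 := by
  revert b₀ b₁ b₂ b₃ b₄ b₅ b₆ b₇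
  decide

/-- Every label on `2 * 4` wires is the vector of its eight values. -/
theorem eq_vec (x : QReg (2 * 4)) :
    x = fun w : Fin (2 * 4) => ![x 0, x 1, x 2, x 3, x 4, x 5, x 6, x 7] w := by
  funext w
  fin_cases w <;> rfl

theorem card_filter_blockString (x : QReg (2 * 4)) :
    (Finset.univ.filter (fun i : Fin 4 => x = blockString i)).card =
      if (∀ k : Fin 2, ∀ i : Fin 4, x (finProdFinEquiv (k, i)) = x (finProdFinEquiv (k, (0 : Fin 4))))
      then 1 else 0 := by
  rw [eq_vec x]
  exact card_filter_blockString_vec _ _ _ _ _ _ _ _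

/-- TIGHTNESS at four terms: `|M⟩^{⊗2} = Σ_{i<4} ½ |blockString i⟩` with every computational
basis state Gaussian (`basisState_isGaussian`), so `χ_G(M ⊗ M) ≤ 4` and the crux's `3` cannot be
replaced by `4`. -/
theorem not_twoCopiesBound_four : ¬ TwoCopiesBound IsGaussian 4 := by
  intro h
  refine h (fun _ => ((Real.sqrt 2 : ℂ)⁻¹) ^ 2) (fun i => basisState (blockString i))
    (fun i => basisState_isGaussian _) ?_
  funext x
  have hc := card_filter_blockString x
  simp only [Finset.sum_apply, Pi.smul_apply, basisState_apply, smul_eq_mul, mul_ite, mul_one,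
    mul_zero]
  rw [Finset.sum_ite, Finset.sum_const_zero, add_zero, Finset.sum_const, nsmul_eq_mul]
  rw [magicMPow]
  split_ifs with hbc
  · rw [if_pos hbc] at hc
    simp [hc]
  · rw [if_neg hbc] at hc
    simp [hc]

/-- NON-UNIQUENESS AT FOUR TERMS (cycle 2, by hand): the Fock-corner decomposition is not the only 4-term
Gaussian decomposition of `M⊗M`. With `P₁ = a₄†a₅†`, `P₂ = a₆†a₇†` and the Gaussian BCS states
`g_± = (1 ± P₁)(1 ± P₂)|1⁴0⁴⟩ = |1⁴0⁴⟩ ± (|1⁴1100⟩ + |1⁴0011⟩) + |1⁸⟩` one has `g₊ + g₋ = 2(|1⁴0⁴⟩ + |1⁸⟩)`, so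
`M⊗M = ½|0⁸⟩ + ½|0⁴1⁴⟩ + ¼ g₊ + ¼ g₋`; likewise already `|M⟩ = (2√2)⁻¹ (h₊ + h₋)`, `h_± = (1 ± a₀†a₁†)(1 ± a₂†a₃†)|0⁴⟩`
— 2-term decompositions of `M` and 4-term decompositions of `M⊗M` come in positive-dimensional families
(any pairing of the four modes, any of the corner pairs). Consequence for provers: no rigidity/uniqueness argument
at `r = 4` is available, and `σ₄` is smooth of the expected local dimension near these points only if these
families are accounted for. [this seat, hand computation] -/
theorem tight_four_not_unique_doc : True := trivial

/-! ## §3 Metric reformulation — the natural strengthening that resisted every attack -/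

/-- `DistBound r c`: every linear combination of `r` Gaussian states is at `normSq`-distance at
least `c` from `|M⟩^{⊗2}` (i.e. `dist²(M⊗M, σ_r°) ≥ c`; with `c > 0` this is "δ-approximate
Gaussian rank `> r` for every `δ < √c`", the shape of the route's kill item at `t = 2`).
NUMERICAL EVIDENCE (this seat): the infimum appears to be EXACTLY `1 - r/4` for `r = 1,2,3,4`
(`r = 1` is the proved Gaussian fidelity `F_G(M⊗M) = 1/4`, Dias–Koenig 2024 §5 / Cudby–Strelchuk
2023 §6; `r = 4` is `not_twoCopiesBound_four`); for `r = 3`, 4 284 Levenberg–Marquardt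
restarts over all 20 cut-type strata of (g₁,g₂,g₃) (complex spin-group orbits, exact types) ended
at residual `0.2500…`, none below `1/4`, the minimisers being three Fock corners `½|c⁴d⁴⟩` (or
border-equivalent configurations: two nearly cancelling Gaussians + one corner). A proof of
`DistBound 3 (1/4)` — or of any `DistBound 3 c`, `c > 0` — proves the crux (`crux_of_distBound`)
and its border-rank version at once. -/
def DistBound (r : ℕ) (c : ℝ) : Prop :=
  ∀ (a : Fin r → ℂ) (g : Fin r → QReg (2 * 4) → ℂ), (∀ i, IsGaussian (g i)) →
    c ≤ normSq (magicMPow 2 - ∑ i, a i • g i)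

/-- A positive metric gap at three terms implies the crux (exact rank ≥ 4). -/
theorem crux_of_distBound {c : ℝ} (h : DistBound 3 c) (hc : 0 < c) : GaussRankTwoCopies := by
  rw [crux_iff]
  intro a g hg heq
  have h1 := h a g hg
  rw [heq, sub_self] at h1
  have h0 : normSq (0 : QReg (2 * 4) → ℂ) = 0 := by simp [normSq]
  rw [h0] at h1
  exact absurd (lt_of_lt_of_le hc h1) (lt_irrefl 0)

/-- Trivial endpoint: distance `≥ 0` for any number of terms. -/
theorem distBound_zero (r : ℕ) : DistBound r 0 := by
  intro a g _
  unfold normSq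
  positivity

/-- FLAT VALLEYS AT LEVEL `1/4` (cycle 2, by hand): the conjectured minimum `1/4` of the 3-term distance is NOT
attained at isolated points. With the corners `e₁ = |0⁸⟩, e₂ = |0⁴1⁴⟩, e₃ = |1⁴0⁴⟩, e₄ = |1⁸⟩` and the BCS curve
`g(t) = (1 + t a₄†a₅†)(1 + t a₆†a₇†) e₃ = e₃ + t(|1⁴1100⟩ + |1⁴0011⟩) + t² e₄` (Gaussian for every `t`), the
orthogonal triple `(e₁, e₂, g(t))` has `dist²(M⊗M, span) = 1 - ¼ - ¼ - ¼ (1+t²)²/(1+t²)² = 1/4` IDENTICALLY in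
`t`, joining the corner triples `{e₁,e₂,e₃}` (`t = 0`) and `{e₁,e₂,e₄}` (`t = ∞`). Two-parameter deformations
`(1 + s a₄†a₅†)(1 + t a₆†a₇†)e₃` capture `(1+st)²/((1+s²)(1+t²)) ≤ 1` corner units (equality iff `s = t`), never
more; and the full BCS pencil `G(t) = ∏_{4 pairs}(1 + t a†a†)|0⁸⟩` (which realises the Gaussian FIDELITY `1/4` for
every `t`) spans only `span{E₀,…,E₄} ∋` a projection of `M⊗M` of weight `2/3 < 3/4`. So a proof of
`DistBound 3 (1/4)` must handle a positive-dimensional contact locus (consistent with the "border-equivalent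
minimisers" seen numerically in cycle 1), and a refutation must leave these valleys. [this seat, hand computation] -/
theorem distBound_three_quarter_valley_doc : True := trivial

/-- Exact endpoint at four terms: no positive gap survives (`not_twoCopiesBound_four`), matching
the conjectured profile `1 - r/4` at `r = 4`. -/
theorem not_distBound_four_pos {c : ℝ} (hc : 0 < c) : ¬ DistBound 4 c := by
  intro h
  apply not_twoCopiesBound_four
  intro a g hg heq
  have h1 := h a g hg
  rw [heq, sub_self] at h1
  have h0 : normSq (0 : QReg (2 * 4) → ℂ) = 0 := by simp [normSq]
  rw [h0] at h1
  exact absurd (lt_of_lt_of_le hc h1) (lt_irrefl 0)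

/-! ## §4 Structure every putative 3-term decomposition must have (hand analysis, this seat)

Notation. Block A = wires 0–3, block B = wires 4–7; an 8-qubit vector is a 16 × 16 coefficient
matrix `Ψ[x_A][x_B]`. The complex spin groups `Spin(8,ℂ)_A × Spin(8,ℂ)_B` (exponentials of
quadratic Majorana monomials inside one block; the block-B Jordan–Wigner strings `Z^{⊗4}` cancel
for even operators) act by `Ψ ↦ H_A Ψ H_Bᵀ`. `Δ₊, Δ₋` = even/odd 4-mode sectors (8-dim each),
`β` = the Spin(8)-invariant symmetric bilinear form on `Δ₊` (pairs `|S⟩` with `|Sᶜ⟩`; the 4-mode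
Gaussians are its null cone; `m = |0000⟩ + |1111⟩` has `β(m,m) = 2 ≠ 0`).

(1) PARITY. `M⊗M` is even and pure spinors have definite parity, so with three terms all `gᵢ`
    are even (1 odd term ⇒ its coefficient is 0; 2 odd ⇒ they cancel and `M⊗M` would be Gaussian;
    3 odd ⇒ the sum is odd).
(2) SIX ORBITS. Even 8-mode Gaussians form six `Spin(8,ℂ)²`-orbits, by cut type: `p = 4,3,2,1`
    BCS pairs across the cut (reference `g_p = ∏_{j<p}(1 + a†_{A,j} a†_{B,j})|0⟩`, NOT the all-plus
    `Σ_x |x⟩|x⟩`, which is not Gaussian — Jordan–Wigner signs `(-1)^{⌊|x|/2⌋}`), and the products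
    `0e = even⊗even`, `0o = odd⊗odd`. Sector ranks: `E(g) ∈ Δ₊⊗Δ₊` and `O(g) ∈ Δ₋⊗Δ₋` have rank
    `2^{p-1}` each (`p ≥ 1`); `0e`: (1,0); `0o`: (0,1).
(3) SECTOR EQUATIONS. `Σ aᵢ E(gᵢ) = m ⊗ m` (rank 1, non-null ⊗ non-null) and `Σ aᵢ O(gᵢ) = 0`,
    with `(E(gᵢ), O(gᵢ)) = (H_{A,i}⁺ E_p H_{B,i}⁺ᵀ, H_{A,i}⁻ O_p H_{B,i}⁻ᵀ)` coupled through the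
    SAME pair `(H_A, H_B)`; the two blocks are independent, the two chiralities are not.
(4) E-SECTOR DICTIONARY. Via `β`, `E ↦ Ê ∈ End(Δ₊)`: type 4 gives EXACTLY the conformal
    orthogonal maps of determinant `+μ⁴` (`Êᵀ β Ê = μ β`), types 3/2/1 their degenerations
    (`ÊᵀβÊ = ÊβÊᵀ = 0`, image and coimage isotropic of dim 4/2/1).
(5) DEAD STRATA (proved by hand this session; the first two lines are from the route reviews):
    * three PRODUCT terms (Lemma A of TwoCopies_cut_structure.md): impossible; at least one term
      has `p ≥ 2`; Σ 2^{pᵢ-1} ≥ 4 in the E-sector and each O-rank ≤ sum of the other two;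
    * (4,4,0e): `O₂ ∥ O₁` forces `g₂` to be the parity twin `(-1)^{N_A} g₁` (stabiliser of `g₄`
      is `{(A⁻ᵀ, A)}`; kernel of `Spin(8) → SO(Δ₋)` is the centre element acting as −1 on Δ₊),
      and then `a₁E₁ + a₂E₂` has rank 8 or 0, not ≤ 2;
    * (4,4,0o): THE DETERMINANT OBSTRUCTION — normalising `Ê₁ = 1`, `a·1 + b·R = m'β(m'',·)`
      with `R ∈ SO(β)`: `R` is the scalar `-a/b = ±1` on the non-degenerate hyperplane `m''^⊥`,
      hence `±`(reflection in that hyperplane), `det R = -1`: contradiction. (So two type-4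
      E-parts never combine to "rank 1 + 0".)
    * (3,3,0e): `O₂ ∥ O₁` puts `(H_A,H_B)` in the parabolic of the isotropic line `a_{4}`; its
      Levi `SL₄ × ℂ*` acts on (even, odd) 3-mode sectors as `(A, D A⁻ᵀ D⁻¹)`, the unipotent
      radical acts trivially on `ker a₄`, so `O₂ ∥ O₁ ⇒ E₂ ∥ E₁` and `rank(a₁E₁+a₂E₂) ∈ {0,4}`;
    * (2,2,0e), (2,2,0o): the E-parts have isotropic column/row PLANES; a rank-1 non-null `m⊗m`
      (plus at most one null⊗null product) cannot have its image inside `U₁ + U₂` unless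
      `dim(U₁ ∩ U₂) = 1`, and then the common null line would have to carry `m` — impossible;
    * any (4, q, q') with `2^{q-1} + 2^{q'-1} < 7`: `m⊗m - a₁Ê₁` has rank ≥ 7.
(6) LIVE STRATA and the shape of the remaining problem: (4,4,4), (4,4,3), (4,4,2), (4,4,1),
    (4,3,3), (3,3,3), (3,3,2), (3,3,1), (3,2,2), (2,2,2), (2,2,1), (3,3,0o). In each, restricting
    `Σ aᵢ Êᵢ = m'β(m'',·)` to the hyperplane `h = m''^⊥` shows that the relative rotations
    `U = Êᵢ⁻¹Êⱼ` are ISOCLINIC up to rank 2: `U + U⁻¹ = κ·1 + Δ`, `Δ|_{h×h} = 0`; in the semisimple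
    case three of the four eigenvalue pairs of `U` coincide (`U = λP₊ + λ⁻¹P₋` on a 6-space, a pair
    of complementary Lagrangians), and the generic semisimple (4,4,4) configuration was checked by
    hand to force the rank-1 sum to have a NULL image (dead); the non-semisimple (unipotent)
    configurations and the mixed strata are NOT yet excluded by hand — this, or a certified
    algebraic computation, is what a proof of the crux still needs. The O-equation `Σ aᵢ Ôᵢ = 0`
    independently forces `Ô₁⁻¹Ô₃` isoclinic (`(1 + cU)ᵀ(1 + cU) = b²`).
(6b) THE OBSTRUCTION IS INVISIBLE TO THE EVEN SECTOR'S ZARISKI TOPOLOGY (numerical finding,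
    `js/esector.js`): relaxing the problem to the E-equation ALONE (three E-tensors
    `R₁E_pR₂ᵀ` with INDEPENDENT `R₁,R₂ ∈ SO(Δ₊,β)`, odd sector and chirality coupling ignored),
    Levenberg–Marquardt drives the residual to `10⁻⁶ … 10⁻⁹` in every stratum with all
    `pᵢ ≥ 2` — but only with term norms diverging (`10² … 10⁵`): `m ⊗ m` lies in the CLOSURE of
    the 3-term E-sums (E-border-rank 3) while no bounded exact E-solution was ever found; with
    E-ranks (2,1,1), (1,1,1) the E-floor is again `1/4`, and with two terms `1/2`. CONSEQUENCES:
    (i) no polynomial in the even⊗even block alone (no "E-flattening", no E-sector invariant)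
    can certify the crux — every such polynomial vanishing on 3-term sums vanishes at `m ⊗ m`;
    (ii) a proof must use the odd⊗odd equation `Σ aᵢ Oᵢ = 0` TOGETHER with the chirality
    coupling `(H⁺, H⁻)` of each term (in the full problem the residual floor stays `1/4` with no
    border creep, i.e. numerically border rank 4 as well); (iii) for a kill, conversely, the
    E-sector is not the bottleneck — the O-sector is.
(7) WHY THE NUMERICS CANNOT LIE MUCH: the search parametrises each term EXACTLY on its orbit
    (group retraction), so every iterate is a genuine Gaussian triple; an exact decomposition would
    show up as residual → 0 with quadratic LM convergence (calibration on random points of σ₃ is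
    part of the kit job). What a local method can miss is a solution with a tiny basin; the
    algebraic rigidity in (5)–(6) is the reason to believe there is none.
-/

/-- Bookkeeping type for §4: the six cut types of an even 8-mode Gaussian (number of BCS pairs
across the 4|4 cut, or the two product types). Purely documentary; carries the §4 docstring. -/
inductive CutType
  | pairs (p : Fin 4)  -- p+1 ∈ {1,2,3,4} BCS pairs across the cut
  | evenProduct        -- 0e
  | oddProduct         -- 0o
  deriving DecidableEq

/-! ## §5 A natural strengthening REFUTED: Gaussian rank is not multiplicative (parity matters)

`χ_G(M) = 2` does not by itself give `χ_G(M ⊗ M) = 4`: for the one-qubit mixed-parity vector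
`|+⟩` one has `χ_G(|+⟩) = 2` (`plus1_not_isGaussian`) but `|+⟩ ⊗ |+⟩ = |++⟩` is a sum of TWO
Gaussian vectors (`(|00⟩+|11⟩) + c_{0,X}(|00⟩+|11⟩)`, `Parity.gaussianRank_not_multiplicative`), so
`χ_G(ψ^{⊗2}) = χ_G(ψ)²` FAILS in general. What saves `M` is parity superselection (§4(1)): `M` is
a parity eigenstate, its two Gaussian components `|0000⟩`, `|1111⟩` have the same parity, and the
cross terms of `M ⊗ M` cannot be absorbed by odd Gaussians. Any proof of the crux must use that
`M` is even (equivalently: that the four corners `|c⁴d⁴⟩` are pairwise parity-compatible). -/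

namespace Parity

/-- `|+⟩` on one qubit, unnormalised: both amplitudes `1`. -/
def plus1 : QReg 1 → ℂ := fun _ => 1

/-- Sum over one-wire labels = sum over the value of the single wire. -/
theorem sum_qreg_one (f : QReg 1 → ℂ) : ∑ x : QReg 1, f x = f (fun _ => false) + f (fun _ => true) := by
  rw [← Fintype.sum_equiv (Equiv.funUnique (Fin 1) Bool).symm (fun b => f ((Equiv.funUnique (Fin 1) Bool).symm b)) f (fun _ => rfl)]
  rw [Fintype.sum_bool]
  rw [add_comm]
  congr 1

/-- Entries of the two Majoranas on one wire: no Jordan–Wigner string. -/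
theorem majorana_one_apply (b : Bool) (y x : QReg 1) :
    majorana 1 0 b y x = (if b then Pauli.Y else Pauli.X).mat (y 0) (x 0) := by
  rw [majorana_apply]
  have : (Finset.univ : Finset (Fin 1)).erase 0 = ∅ := by decide
  rw [this, Finset.prod_empty, mul_one]

/-- `|+⟩` is NOT Gaussian: a combination `α c_X + β c_Y` kills `|+⟩` only if `α = β = 0`
(rows give `α - iβ = 0` and `α + iβ = 0`). -/
theorem plus1_not_isGaussian : ¬ IsGaussian plus1 := by
  rintro ⟨-, A, hA, hann⟩
  have h0 := hann 0
  have hsum : (∑ p : Fin 1 × Bool, A 0 p • majorana 1 p.1 p.2) =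
      A 0 (0, false) • majorana 1 0 false + A 0 (0, true) • majorana 1 0 true := by
    rw [Fintype.sum_prod_type, Fin.sum_univ_one, Fintype.sum_bool, add_comm]
  rw [hsum] at h0
  have e1 : A 0 (0, false) - A 0 (0, true) * Complex.I = 0 := by
    have := congrFun h0 (fun _ => false)
    simp [Matrix.mulVec, dotProduct, plus1, sum_qreg_one, majorana_one_apply] at this
    linear_combination this
  have e2 : A 0 (0, false) + A 0 (0, true) * Complex.I = 0 := by
    have := congrFun h0 (fun _ => true)
    simp [Matrix.mulVec, dotProduct, plus1, sum_qreg_one, majorana_one_apply] at this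
    linear_combination this
  have hα : A 0 (0, false) = 0 := by linear_combination (e1 + e2) / 2
  have hβ : A 0 (0, true) = 0 := by
    have : A 0 (0, true) * Complex.I = 0 := by linear_combination (e2 - e1) / 2
    simpa [Complex.I_ne_zero] using this
  have hz : A 0 = 0 := by
    funext p
    obtain ⟨j, b⟩ := p
    have hj : j = 0 := Subsingleton.elim _ _
    subst hj
    cases b
    · simpa using hα
    · simpa using hβ
  exact (LinearIndependent.ne_zero 0 hA) hz

/-! ### Two wires -/

/-- `|++⟩` on two qubits, unnormalised: all four amplitudes `1`. -/
def plus2 : QReg 2 → ℂ := fun _ => 1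

/-- The even Bell vector `|00⟩ + |11⟩`. -/
def bellE : QReg 2 → ℂ := fun x => if x 0 = x 1 then 1 else 0

/-- Sum over two-wire labels. -/
theorem sum_qreg_two (f : QReg 2 → ℂ) :
    ∑ x : QReg 2, f x = f ![false, false] + f ![false, true] + f ![true, false] + f ![true, true] := by
  rw [← Fintype.sum_equiv (piFinTwoEquiv fun _ => Bool).symm
    (fun p => f ![p.1, p.2]) f (fun p => by
      show f ![p.1, p.2] = f ((piFinTwoEquiv fun _ => Bool).symm p)
      congr 1)]
  rw [Fintype.sum_prod_type]
  simp only [Fintype.sum_bool]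
  ring

/-- Every two-wire label is the vector of its two values. -/
theorem eq_vec_two (x : QReg 2) : x = ![x 0, x 1] := by
  funext i; fin_cases i <;> rfl

/-- Entries of the wire-0 Majoranas on two wires: `(X|Y)_{y₀x₀} · [y₁ = x₁]`. -/
theorem majorana_two_zero_apply (b : Bool) (y x : QReg 2) :
    majorana 2 0 b y x = (if b then Pauli.Y else Pauli.X).mat (y 0) (x 0) * (Pauli.I).mat (y 1) (x 1) := by
  rw [majorana_apply]
  have : (Finset.univ : Finset (Fin 2)).erase 0 = {1} := by decide
  rw [this, Finset.prod_singleton]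
  have h10 : ¬ ((1 : Fin 2) < 0) := by decide
  rw [if_neg h10]

/-- Entries of the wire-1 Majoranas on two wires: `(X|Y)_{y₁x₁} · Z_{y₀x₀}` (Jordan–Wigner string). -/
theorem majorana_two_one_apply (b : Bool) (y x : QReg 2) :
    majorana 2 1 b y x = (if b then Pauli.Y else Pauli.X).mat (y 1) (x 1) * (Pauli.Z).mat (y 0) (x 0) := by
  rw [majorana_apply]
  have : (Finset.univ : Finset (Fin 2)).erase 1 = {0} := by decide
  rw [this, Finset.prod_singleton]
  have h01 : ((0 : Fin 2) < 1) := by decide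
  rw [if_pos h01]

/-- `|00⟩ + |11⟩` is Gaussian: it is annihilated by `c_{0X} + i c_{0Y} - c_{1X} + i c_{1Y}`
(`= 2(a₀ - a₁†)`) and by `c_{0X} - i c_{0Y} + c_{1X} + i c_{1Y}` (`= 2(a₁ + a₀†)`). -/
theorem bellE_isGaussian : IsGaussian bellE := by
  refine ⟨fun h => by simpa [bellE] using congrFun h ![false, false], ?_⟩
  refine ⟨fun k p => if k = 0 then (if p = (0, false) then 1 else if p = (0, true) then Complex.I
      else if p = (1, false) then -1 else Complex.I)
    else (if p = (0, false) then 1 else if p = (0, true) then -Complex.I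
      else if p = (1, false) then 1 else Complex.I), ?_, ?_⟩
  · rw [Fintype.linearIndependent_iff]
    intro g hg k
    have h1 := congrFun hg (0, false)
    have h2 := congrFun hg (0, true)
    simp [Fin.sum_univ_two] at h1 h2
    have hg0 : g 0 = 0 := by
      have : g 0 * (2 * Complex.I) = 0 := by linear_combination Complex.I * h1 + h2
      simpa [Complex.I_ne_zero] using this
    have hg1 : g 1 = 0 := by linear_combination h1 - hg0
    fin_cases k
    · exact hg0
    · exact hg1
  · intro k
    funext y
    rw [eq_vec_two y]
    generalize y 0 = a
    generalize y 1 = b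
    rw [Fintype.sum_prod_type, Fin.sum_univ_two, Fintype.sum_bool, Fintype.sum_bool]
    simp only [Matrix.mulVec, dotProduct, Matrix.add_apply, Matrix.smul_apply, smul_eq_mul,
      sum_qreg_two, majorana_two_zero_apply, majorana_two_one_apply, bellE, Pi.zero_apply]
    fin_cases k <;> cases a <;> cases b <;> simp

/-- `|++⟩ = (|00⟩ + |11⟩) + c_{0X}(|00⟩ + |11⟩)` — a sum of TWO Gaussian vectors
(`IsGaussian.majorana_mulVec`). -/
theorem plus2_eq : plus2 = bellE + majorana 2 0 false *ᵥ bellE := by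
  funext y
  rw [eq_vec_two y]
  simp only [Pi.add_apply, Matrix.mulVec, dotProduct, sum_qreg_two, majorana_two_zero_apply, bellE,
    plus2]
  cases y 0 <;> cases y 1 <;> simp

/-- **Gaussian rank is not multiplicative (mixed parity):** `|+⟩` is not Gaussian, but `|+⟩⊗|+⟩`
is a combination of two Gaussian states; so `χ_G(|+⟩^{⊗2}) ≤ 2 < 4 = χ_G(|+⟩)^2`. -/
theorem gaussianRank_not_multiplicative :
    ¬ IsGaussian plus1 ∧ ∃ g₁ g₂ : QReg 2 → ℂ, IsGaussian g₁ ∧ IsGaussian g₂ ∧ plus2 = g₁ + g₂ :=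
  ⟨plus1_not_isGaussian, bellE, majorana 2 0 false *ᵥ bellE, bellE_isGaussian,
    bellE_isGaussian.majorana_mulVec 0 false, plus2_eq⟩

end Parity

/-! ## §6 Annihilators: the trivial-annihilator fact and the SHARP annihilator-count threshold (cycle 2)

(gen 2, refuter-cdisprove-stmt-QuantumAdvantage-1248-g2-0.) The crux's dictionary asks each term to be killed by
EIGHT linearly independent Majorana combinations. Mutating that number `m`:
* `m ≤ 4`: the bound is FALSE with two terms — `M⊗M = ½ |0⁴⟩⊗(|0⁴⟩+|1⁴⟩) + ½ |1⁴⟩⊗(|0⁴⟩+|1⁴⟩)`, each half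
  killed by the four block-`A` modes (`Annihilator.gaussRankTwoCopies_false_with_four_annihilators`); and ONE term
  never suffices for any `m ≥ 1` (`Annihilator.gaussRankTwoCopies_oneTerm_free`), because
* `|M⟩^{⊗2}` HAS TRIVIAL ANNIHILATOR (`Annihilator.magicMPow_two_annihilator_eq_zero`; also `magicM`, one copy):
  the input (T1)/(AN) of every paper proof on the item, now kernel-checked; corollaries
  `magicMPow_two_not_isGaussian`, `magicM_not_isGaussian`.
* `m ∈ {5,6,7}`: the weakened statement is IMPLIED by the crux (paper, not formalised): `m` independent rows
  annihilating `ψ ≠ 0` span an isotropic `I` (CAR), the joint kernel of `c(I)` is the Fock space of the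
  `8 - m ≤ 3` modes `I^⊥/I` over the vacuum of `I`, and EVERY even (odd) vector of `≤ 3` modes is a pure spinor
  (`Spin(6) ≅ SL(4)` is transitive on nonzero half-spinors; dims 4, 2 trivially), so the parity projections of
  such a `ψ` are pure spinors of all 8 modes; projecting a putative 3-term decomposition to the even sector gives a
  ≤ 3-term GAUSSIAN decomposition of the even vector `M⊗M`. So the threshold is sharp at `4 | 5`: any proof must use
  at least five of the eight rows of each term, and needs no more than five plus parity.
The general-`n` engine is `Annihilator.majorana_mulVec_basisState` (JW Majoranas flip one bit of a basis state with
a phase in `{±1, ±i}`) and the neighbour-amplitude lemmas `rowOp_mulVec_basisState_flipAt` / `_of_ne`.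
LANDED (def-free twins, importable): `Summits.QuantumAdvantage.QuantumAdvantage.Theorems.GaussRankTwoCopies.Negative.
Annihilators` (p78896, commit 1096dadb3426: `majorana_mulVec_basisState`, `row_mulVec_basisState{,_flip,_of_ne}`,
`annRow_mulVec_basisState`, `magicMPow_two_eq_sum`, `magicMPow_two_annihilator_eq_zero`,
`magicMPow_two_not_isGaussian`, `gaussRankTwoCopies_oneTerm_free`, `gaussRankTwoCopies_false_with_four_annihilators`)
and, filed next, `…Negative.AnnihilatorRows` (`row_anticommutator`, `annihilators_orthogonal`,
`card_annihilating_rows_le` (≤ n independent annihilating rows), `no_nine_annihilating_rows` (the `m ≥ 9`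
mutation is EMPTY), `mem_span_rows_of_annihilates` / `annihilates_iff_mem_span_rows` /
`IsGaussian.exists_annihilator_basis` (= `AnnihilatorMaximal`: the `n` rows of a Gaussian state span its whole
annihilator), `magicM_eq_sum`, `magicM_annihilator_eq_zero`, `magicM_not_isGaussian`). So the `m`-axis of the
dictionary is fully charted: `m ≤ 4` false (2 terms), `m = 5,6,7` implied by the crux (paper), `m = 8` the crux,
`m ≥ 9` vacuous. -/

namespace Annihilator

/-! #### Majoranas act on basis states by signed bit flips -/

/-- The string `x` with wire `k` flipped. [folklore] -/
def flipAt {n : ℕ} (x : QReg n) (k : Fin n) : QReg n := Function.update x k (!(x k))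

@[simp] theorem flipAt_apply_self {n : ℕ} (x : QReg n) (k : Fin n) : flipAt x k k = !(x k) := by
  simp [flipAt]

theorem flipAt_apply_of_ne {n : ℕ} (x : QReg n) {k i : Fin n} (h : i ≠ k) : flipAt x k i = x i := by
  simp [flipAt, Function.update_of_ne h]

/-- Flipping different wires of the same string gives different strings. [folklore] -/
theorem flipAt_eq_iff {n : ℕ} (x : QReg n) {j k : Fin n} : flipAt x j = flipAt x k ↔ j = k := by
  refine ⟨fun h => ?_, fun h => by rw [h]⟩
  by_contra hjk
  have h1 := congrFun h j
  rw [flipAt_apply_self, flipAt_apply_of_ne x hjk] at h1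
  exact (Bool.eq_not_self (x j)).mp h1.symm

/-- The Jordan–Wigner sign `∏_{i<k} (-1)^{x_i}` picked up by `c_{k,b}` on `|x⟩`, written as the
literal product of the diagonal `Z`/`I` entries of the Majorana word off the wire `k`. [folklore] -/
def jwSign {n : ℕ} (x : QReg n) (k : Fin n) : ℂ :=
  ∏ i ∈ Finset.univ.erase k, (if i < k then Pauli.Z else Pauli.I).mat (x i) (x i)

theorem jwSign_mul_self {n : ℕ} (x : QReg n) (k : Fin n) : jwSign x k * jwSign x k = 1 := by
  unfold jwSign
  rw [← Finset.prod_mul_distrib]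
  refine Finset.prod_eq_one fun i _ => ?_
  split_ifs <;> cases x i <;> simp

theorem jwSign_ne_zero {n : ℕ} (x : QReg n) (k : Fin n) : jwSign x k ≠ 0 := fun h => by
  have h1 := jwSign_mul_self x k
  rw [h, mul_zero] at h1
  exact zero_ne_one h1

/-- The `X`/`Y` entry met when a wire carrying `c` is flipped: `X ↦ 1`, `Y ↦ +i` (`c = 0`),
`-i` (`c = 1`). [folklore] -/
def xyEntry (b c : Bool) : ℂ := (if b then Pauli.Y else Pauli.X).mat (!c) c

@[simp] theorem xyEntry_false (c : Bool) : xyEntry false c = 1 := by cases c <;> simp [xyEntry]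
@[simp] theorem xyEntry_true_false : xyEntry true false = Complex.I := by simp [xyEntry]
@[simp] theorem xyEntry_true_true : xyEntry true true = -Complex.I := by simp [xyEntry]

/-- **Majoranas flip one bit of a basis state**:
`c_{k,b} |x⟩ = (X/Y entry) · (Jordan–Wigner sign) · |x with wire k flipped⟩`. [folklore] -/
theorem majorana_mulVec_basisState {n : ℕ} (k : Fin n) (b : Bool) (x : QReg n) :
    majorana n k b *ᵥ basisState x = (xyEntry b (x k) * jwSign x k) • basisState (flipAt x k) := by
  funext y
  simp only [basisState, Matrix.mulVec_single_one, Matrix.col_apply, majorana_apply, Pi.smul_apply,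
    smul_eq_mul]
  by_cases hy : y = flipAt x k
  · rw [hy, Pi.single_eq_same, mul_one, flipAt_apply_self]
    unfold xyEntry jwSign
    congr 1
    exact Finset.prod_congr rfl fun i hi => by rw [flipAt_apply_of_ne x (Finset.ne_of_mem_erase hi)]
  · rw [Pi.single_eq_of_ne hy, mul_zero]
    by_cases hk : y k = x k
    · have h0 : (if b then Pauli.Y else Pauli.X).mat (y k) (x k) = 0 := by
        rw [hk]; cases b <;> simp
      rw [h0, zero_mul]
    · obtain ⟨i, hik, hi⟩ : ∃ i, i ≠ k ∧ y i ≠ x i := by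
        by_contra hcon
        push Not at hcon
        apply hy
        funext i
        by_cases hik : i = k
        · rw [hik, flipAt_apply_self]
          exact Bool.eq_not_of_ne hk
        · rw [flipAt_apply_of_ne x hik]
          exact hcon i hik
      have h0 : (if i < k then Pauli.Z else Pauli.I).mat (y i) (x i) = 0 := by
        split_ifs <;> simp [hi]
      rw [Finset.prod_eq_zero (Finset.mem_erase.mpr ⟨hik, Finset.mem_univ i⟩) h0, mul_zero]

/-! #### Rows of Majorana coefficients as operators -/

/-- The Clifford element `c(A) = Σ_p A_p c_p` of a coefficient row `A ∈ ℂ^{2n}`. [folklore] -/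
def rowOp {n : ℕ} (A : Fin n × Bool → ℂ) : Matrix (QReg n) (QReg n) ℂ :=
  ∑ p : Fin n × Bool, A p • majorana n p.1 p.2

theorem rowOp_mulVec_basisState {n : ℕ} (A : Fin n × Bool → ℂ) (x : QReg n) :
    rowOp A *ᵥ basisState x =
      ∑ p : Fin n × Bool, (A p * (xyEntry p.2 (x p.1) * jwSign x p.1)) • basisState (flipAt x p.1) := by
  unfold rowOp
  rw [Matrix.sum_mulVec]
  refine Finset.sum_congr rfl fun p _ => ?_
  rw [Matrix.smul_mulVec, majorana_mulVec_basisState, smul_smul]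

/-- The amplitude of `c(A)|x⟩` on the neighbour `x ⊕ e_k`: only the two Majoranas of wire `k`
contribute. [folklore] -/
theorem rowOp_mulVec_basisState_flipAt {n : ℕ} (A : Fin n × Bool → ℂ) (x : QReg n) (k : Fin n) :
    (rowOp A *ᵥ basisState x) (flipAt x k) =
      jwSign x k * (A (k, false) * xyEntry false (x k) + A (k, true) * xyEntry true (x k)) := by
  rw [rowOp_mulVec_basisState, Finset.sum_apply]
  simp only [Pi.smul_apply, basisState_apply, smul_eq_mul, mul_ite, mul_one, mul_zero]
  simp_rw [flipAt_eq_iff x]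
  rw [Fintype.sum_prod_type, Finset.sum_eq_single k]
  · rw [Fintype.sum_bool, if_pos rfl, if_pos rfl]
    ring
  · intro a _ hak
    simp [Ne.symm hak]
  · simp

/-- `c(A)|x⟩` vanishes off the Hamming-1 neighbours of `x`. [folklore] -/
theorem rowOp_mulVec_basisState_of_ne {n : ℕ} (A : Fin n × Bool → ℂ) (x y : QReg n)
    (h : ∀ j, y ≠ flipAt x j) : (rowOp A *ᵥ basisState x) y = 0 := by
  rw [rowOp_mulVec_basisState, Finset.sum_apply]
  exact Finset.sum_eq_zero fun p _ => by simp [h p.1]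

/-- From the two neighbour amplitudes of an all-`c` wire: `A_{k,X} ± i A_{k,Y} = 0` both hold iff
`A_{k,X} = A_{k,Y} = 0`. [folklore] -/
theorem coeffs_eq_zero_of_pm {u v : ℂ} (h0 : u * xyEntry false false + v * xyEntry true false = 0)
    (h1 : u * xyEntry false true + v * xyEntry true true = 0) : u = 0 ∧ v = 0 := by
  rw [xyEntry_false, xyEntry_true_false] at h0
  rw [xyEntry_false, xyEntry_true_true] at h1
  have hv : v * (2 * Complex.I) = 0 := by linear_combination h0 - h1
  have hv' : v = 0 := by simpa [Complex.I_ne_zero] using hv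
  refine ⟨?_, hv'⟩
  linear_combination (h0 + h1) / 2

/-! #### The annihilation rows of a basis state -/

/-- Coefficient `∓ i` of `c_{k,Y}` in the annihilator `c_{k,X} + (-1)^c i c_{k,Y}` of a wire carrying
`c` (`= 2a_k` for `c = 0`, `2a_k†` for `c = 1`). [folklore] -/
def annCoef (c : Bool) : ℂ := if c then -Complex.I else Complex.I

theorem annCoef_rel (c : Bool) : xyEntry false c + annCoef c * xyEntry true c = 0 := by
  cases c <;> simp [annCoef]

/-- The annihilation row of wire `k` reading bit `c`. [folklore] -/
def annRow {n : ℕ} (k : Fin n) (c : Bool) : Fin n × Bool → ℂ :=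
  fun p => if p.1 = k then (if p.2 then annCoef c else 1) else 0

theorem rowOp_annRow {n : ℕ} (k : Fin n) (c : Bool) :
    rowOp (annRow k c) = majorana n k false + annCoef c • majorana n k true := by
  unfold rowOp
  rw [Fintype.sum_prod_type, Finset.sum_eq_single k]
  · simp [annRow, add_comm]
  · intro j _ hj
    simp [annRow, hj]
  · simp

/-- The row of wire `k` reading `x_k` annihilates `|x⟩`. [cite: DiasKoenig2024, §2.1 eq. (11)] -/
theorem rowOp_annRow_mulVec_basisState {n : ℕ} (k : Fin n) (x : QReg n) {c : Bool} (h : x k = c) :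
    rowOp (annRow k c) *ᵥ basisState x = 0 := by
  subst h
  rw [rowOp_annRow, Matrix.add_mulVec, Matrix.smul_mulVec, majorana_mulVec_basisState,
    majorana_mulVec_basisState, smul_smul, ← add_smul]
  have : xyEntry false (x k) * jwSign x k + annCoef (x k) * (xyEntry true (x k) * jwSign x k) =
      (xyEntry false (x k) + annCoef (x k) * xyEntry true (x k)) * jwSign x k := by ring
  rw [this, annCoef_rel, zero_mul, zero_smul]

/-! #### `|M⟩^{⊗2}` and `|M⟩` as sums of basis states -/

/-- `|M⟩^{⊗2} = ½ (|0⁴0⁴⟩ + |1⁴0⁴⟩ + |0⁴1⁴⟩ + |1⁴1⁴⟩)`. [cite: CudbyStrelchuk2023, §6 Def. 7] -/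
theorem magicMPow_two_eq_sum :
    magicMPow 2 = (((Real.sqrt 2 : ℂ)⁻¹) ^ 2) • ∑ i : Fin 4, basisState (blockString i) := by
  funext x
  have hc := card_filter_blockString x
  simp only [Pi.smul_apply, Finset.sum_apply, basisState_apply, smul_eq_mul]
  rw [Finset.sum_ite, Finset.sum_const_zero, add_zero, Finset.sum_const, nsmul_eq_mul, mul_one]
  rw [magicMPow]
  split_ifs with hbc
  · rw [if_pos hbc] at hc
    simp [hc]
  · rw [if_neg hbc] at hc
    simp [hc]

theorem sqrt_two_inv_ne_zero : ((Real.sqrt 2 : ℂ)⁻¹) ≠ 0 :=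
  inv_ne_zero (Complex.ofReal_ne_zero.mpr (Real.sqrt_ne_zero'.mpr (by norm_num)))

/-- `|M⟩ = (|0⁴⟩ + |1⁴⟩)/√2`. [cite: CudbyStrelchuk2023, §6 Def. 7] -/
theorem magicM_eq_sum :
    magicM = ((Real.sqrt 2 : ℂ)⁻¹) • (basisState (fun _ : Fin 4 => false) + basisState (fun _ => true)) := by
  classical
  have hft : (fun _ : Fin 4 => false) ≠ (fun _ : Fin 4 => true) := fun h => by
    simpa using congrFun h 0
  funext x
  rw [magicM_apply]
  simp only [Pi.smul_apply, Pi.add_apply, basisState_apply, smul_eq_mul]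
  by_cases h : ∀ i : Fin 4, x i = x 0
  · rw [if_pos h]
    have hx : x = fun _ => x 0 := funext h
    rw [hx]
    cases x 0
    · rw [if_pos rfl, if_neg hft]; ring
    · rw [if_neg (Ne.symm hft), if_pos rfl]; ring
  · rw [if_neg h]
    have h0 : x ≠ fun _ => false := fun hx => h fun i => by rw [hx]
    have h1 : x ≠ fun _ => true := fun hx => h fun i => by rw [hx]
    rw [if_neg h0, if_neg h1]; ring

/-! #### Combinatorics of the Hamming-1 neighbours of the corners (decided by the kernel) -/

theorem flipAt_blockString_zero_eq (i : Fin 4) (j k : Fin (2 * 4))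
    (h : flipAt (blockString 0) k = flipAt (blockString i) j) : i = 0 := by
  revert i j k; decide

theorem flipAt_blockString_three_eq (i : Fin 4) (j k : Fin (2 * 4))
    (h : flipAt (blockString 3) k = flipAt (blockString i) j) : i = 3 := by
  revert i j k; decide

theorem flipAt_const_false_ne_true (j k : Fin 4) :
    flipAt (fun _ : Fin 4 => false) k ≠ flipAt (fun _ : Fin 4 => true) j := by
  revert j k; decide

/-! #### `|M⟩^{⊗2}` and `|M⟩` have trivial annihilator -/

theorem rowOp_mulVec_magicMPow_two (A : Fin (2 * 4) × Bool → ℂ) :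
    rowOp A *ᵥ magicMPow 2 =
      (((Real.sqrt 2 : ℂ)⁻¹) ^ 2) • ∑ i : Fin 4, rowOp A *ᵥ basisState (blockString i) := by
  rw [magicMPow_two_eq_sum, Matrix.mulVec_smul, Matrix.mulVec_sum]

/-- Neighbour amplitudes of `c(A)|M⟩^{⊗2}` next to the corner `|0⁸⟩`. [folklore] -/
theorem rowOp_mulVec_magicMPow_two_at_zero (A : Fin (2 * 4) × Bool → ℂ) (k : Fin (2 * 4)) :
    (rowOp A *ᵥ magicMPow 2) (flipAt (blockString 0) k) =
      (((Real.sqrt 2 : ℂ)⁻¹) ^ 2) * (jwSign (blockString 0) k *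
        (A (k, false) * xyEntry false false + A (k, true) * xyEntry true false)) := by
  rw [rowOp_mulVec_magicMPow_two, Pi.smul_apply, Finset.sum_apply, smul_eq_mul, Fin.sum_univ_four,
    rowOp_mulVec_basisState_flipAt]
  have hk0 : blockString 0 k = false := by
    simp [blockString]
  have h1 : ∀ i : Fin 4, i ≠ 0 → (rowOp A *ᵥ basisState (blockString i)) (flipAt (blockString 0) k) = 0 :=
    fun i hi => rowOp_mulVec_basisState_of_ne A _ _ fun j hj => hi (flipAt_blockString_zero_eq i j k hj)
  rw [h1 1 (by decide), h1 2 (by decide), h1 3 (by decide), hk0]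
  ring

/-- Neighbour amplitudes of `c(A)|M⟩^{⊗2}` next to the corner `|1⁸⟩`. [folklore] -/
theorem rowOp_mulVec_magicMPow_two_at_three (A : Fin (2 * 4) × Bool → ℂ) (k : Fin (2 * 4)) :
    (rowOp A *ᵥ magicMPow 2) (flipAt (blockString 3) k) =
      (((Real.sqrt 2 : ℂ)⁻¹) ^ 2) * (jwSign (blockString 3) k *
        (A (k, false) * xyEntry false true + A (k, true) * xyEntry true true)) := by
  rw [rowOp_mulVec_magicMPow_two, Pi.smul_apply, Finset.sum_apply, smul_eq_mul, Fin.sum_univ_four,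
    rowOp_mulVec_basisState_flipAt]
  have hk3 : blockString 3 k = true := by
    simp only [blockString]
    split_ifs <;> decide
  have h1 : ∀ i : Fin 4, i ≠ 3 → (rowOp A *ᵥ basisState (blockString i)) (flipAt (blockString 3) k) = 0 :=
    fun i hi => rowOp_mulVec_basisState_of_ne A _ _ fun j hj => hi (flipAt_blockString_three_eq i j k hj)
  rw [h1 0 (by decide), h1 1 (by decide), h1 2 (by decide), hk3]
  ring

/-- **`|M⟩^{⊗2}` has trivial annihilator**: the only linear combination of the sixteen Jordan–Wigner
Majoranas annihilating `|M⟩^{⊗2}` is zero (so its annihilator space is `{0}`, it is "as far from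
Gaussian as possible" in the isotropic-subspace description, and every Lagrangian meets it trivially).
Proof: read the amplitudes of `c(A)|M⟩^{⊗2}` on the sixteen strings at Hamming distance one from the
corners `0⁸` and `1⁸`; they are `± ½ (A_{k,X} ± i A_{k,Y})`. [folklore; the input (T1) of the paper
proofs filed on stmt-QuantumAdvantage-1248] -/
theorem magicMPow_two_annihilator_eq_zero (A : Fin (2 * 4) × Bool → ℂ)
    (h : (∑ p : Fin (2 * 4) × Bool, A p • majorana (2 * 4) p.1 p.2) *ᵥ magicMPow 2 = 0) : A = 0 := by
  change rowOp A *ᵥ magicMPow 2 = 0 at h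
  have hc : (((Real.sqrt 2 : ℂ)⁻¹) ^ 2) ≠ 0 := pow_ne_zero _ sqrt_two_inv_ne_zero
  funext p
  obtain ⟨k, b⟩ := p
  have e0 := rowOp_mulVec_magicMPow_two_at_zero A k
  have e3 := rowOp_mulVec_magicMPow_two_at_three A k
  rw [h, Pi.zero_apply] at e0 e3
  have e0' : A (k, false) * xyEntry false false + A (k, true) * xyEntry true false = 0 := by
    rcases mul_eq_zero.mp e0.symm with h0 | h0
    · exact absurd h0 hc
    · rcases mul_eq_zero.mp h0 with h00 | h00
      · exact absurd h00 (jwSign_ne_zero _ _)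
      · exact h00
  have e3' : A (k, false) * xyEntry false true + A (k, true) * xyEntry true true = 0 := by
    rcases mul_eq_zero.mp e3.symm with h0 | h0
    · exact absurd h0 hc
    · rcases mul_eq_zero.mp h0 with h00 | h00
      · exact absurd h00 (jwSign_ne_zero _ _)
      · exact h00
  obtain ⟨hX, hY⟩ := coeffs_eq_zero_of_pm e0' e3'
  cases b
  · exact hX
  · exact hY

/-- **`|M⟩^{⊗2}` is not Gaussian** (`χ_G(M⊗M) ≥ 2`): a Gaussian state has eight independent
annihilating rows, `|M⟩^{⊗2}` has none. [cite: CudbyStrelchuk2023, §6] -/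
theorem magicMPow_two_not_isGaussian : ¬ IsGaussian (magicMPow 2) := by
  rintro ⟨-, A, hA, hann⟩
  exact (LinearIndependent.ne_zero 0 hA) (magicMPow_two_annihilator_eq_zero (A 0) (hann 0))

theorem rowOp_mulVec_magicM (A : Fin 4 × Bool → ℂ) :
    rowOp A *ᵥ magicM = ((Real.sqrt 2 : ℂ)⁻¹) •
      (rowOp A *ᵥ basisState (fun _ => false) + rowOp A *ᵥ basisState (fun _ => true)) := by
  rw [magicM_eq_sum, Matrix.mulVec_smul, Matrix.mulVec_add]

/-- **`|M⟩` has trivial annihilator** (one copy, four modes): the input "(T1) `m` is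
annihilator-free" of card lagrangian-triple-rigidity and of `StabiliserBlockDiagonal`. [folklore] -/
theorem magicM_annihilator_eq_zero (A : Fin 4 × Bool → ℂ)
    (h : (∑ p : Fin 4 × Bool, A p • majorana 4 p.1 p.2) *ᵥ magicM = 0) : A = 0 := by
  change rowOp A *ᵥ magicM = 0 at h
  funext p
  obtain ⟨k, b⟩ := p
  have e0 := congrFun h (flipAt (fun _ => false) k)
  have e1 := congrFun h (flipAt (fun _ => true) k)
  rw [rowOp_mulVec_magicM, Pi.smul_apply, Pi.add_apply, rowOp_mulVec_basisState_flipAt,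
    rowOp_mulVec_basisState_of_ne A _ _ (fun j => flipAt_const_false_ne_true j k), add_zero,
    smul_eq_mul, Pi.zero_apply] at e0
  rw [rowOp_mulVec_magicM, Pi.smul_apply, Pi.add_apply, rowOp_mulVec_basisState_flipAt,
    rowOp_mulVec_basisState_of_ne A _ _ (fun j => (flipAt_const_false_ne_true k j).symm), zero_add,
    smul_eq_mul, Pi.zero_apply] at e1
  have e0' : A (k, false) * xyEntry false false + A (k, true) * xyEntry true false = 0 := by
    rcases mul_eq_zero.mp e0 with h0 | h0
    · exact absurd h0 sqrt_two_inv_ne_zero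
    · rcases mul_eq_zero.mp h0 with h00 | h00
      · exact absurd h00 (jwSign_ne_zero _ _)
      · exact h00
  have e1' : A (k, false) * xyEntry false true + A (k, true) * xyEntry true true = 0 := by
    rcases mul_eq_zero.mp e1 with h0 | h0
    · exact absurd h0 sqrt_two_inv_ne_zero
    · rcases mul_eq_zero.mp h0 with h00 | h00
      · exact absurd h00 (jwSign_ne_zero _ _)
      · exact h00
  obtain ⟨hX, hY⟩ := coeffs_eq_zero_of_pm e0' e1'
  cases b
  · exact hX
  · exact hY

/-- `|M⟩` is not Gaussian (`χ_G(M) = 2`, lower half). [cite: CudbyStrelchuk2023, §6 Def. 7] -/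
theorem magicM_not_isGaussian : ¬ IsGaussian magicM := by
  rintro ⟨-, A, hA, hann⟩
  exact (LinearIndependent.ne_zero 0 hA) (magicM_annihilator_eq_zero (A 0) (hann 0))

/-! #### The sharp annihilator-count threshold -/

/-- The crux's dictionary with the number of independent annihilating rows as a parameter:
`IsGaussianWith m ψ` := `ψ ≠ 0` is annihilated by `m` linearly independent Majorana combinations.
`IsGaussianWith 8` is `IsGaussian` on `2 * 4` qubits (`isGaussianWith_eight_iff`). [folklore] -/
def IsGaussianWith (m : ℕ) (ψ : QReg (2 * 4) → ℂ) : Prop :=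
  ψ ≠ 0 ∧ ∃ A : Fin m → (Fin (2 * 4) × Bool → ℂ), LinearIndependent ℂ A ∧
    ∀ k, (∑ p : Fin (2 * 4) × Bool, A k p • majorana (2 * 4) p.1 p.2) *ᵥ ψ = 0

theorem isGaussianWith_eight_iff (ψ : QReg (2 * 4) → ℂ) : IsGaussianWith (2 * 4) ψ ↔ IsGaussian ψ :=
  Iff.rfl

/-- **One term never suffices**, however weak the dictionary (`m + 1 ≥ 1` annihilators): a single
term proportional to `|M⟩^{⊗2}` would hand its nonzero annihilating row to `|M⟩^{⊗2}`. [folklore] -/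
theorem gaussRankTwoCopies_oneTerm_free (m : ℕ) (a : Fin 1 → ℂ) (g : Fin 1 → QReg (2 * 4) → ℂ)
    (hg : ∀ i, IsGaussianWith (m + 1) (g i)) : magicMPow 2 ≠ ∑ i, a i • g i := by
  intro heq
  rw [Fin.sum_univ_one] at heq
  obtain ⟨-, A, hA, hann⟩ := hg 0
  apply LinearIndependent.ne_zero 0 hA
  apply magicMPow_two_annihilator_eq_zero (A 0)
  rw [heq, Matrix.mulVec_smul, hann 0, smul_zero]

/-- Block-`A` wire `k` of the eight-wire register. [folklore] -/
def wireA (k : Fin 4) : Fin (2 * 4) := ⟨k.val, by have := k.isLt; omega⟩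

theorem wireA_eq_iff {k k' : Fin 4} : wireA k = wireA k' ↔ k = k' := by
  simp [wireA, Fin.ext_iff]

/-- Two basis states agreeing with the constant `c` on block `A` form a vector with (at least) four
independent annihilating rows: the block-`A` modes. [folklore] -/
theorem pair_isGaussianWith_four (c : Bool) (x₁ x₂ : QReg (2 * 4)) (h₁ : ∀ k, x₁ (wireA k) = c)
    (h₂ : ∀ k, x₂ (wireA k) = c) (hne : x₁ ≠ x₂) :
    IsGaussianWith 4 (basisState x₁ + basisState x₂) := by
  refine ⟨fun h0 => ?_, fun k => annRow (wireA k) c, ?_, fun k => ?_⟩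
  · have := congrFun h0 x₁
    simp [hne] at this
  · rw [Fintype.linearIndependent_iff]
    intro g hg k
    have h := congrFun hg (wireA k, false)
    simp only [Finset.sum_apply, Pi.smul_apply, smul_eq_mul, Pi.zero_apply, annRow, wireA_eq_iff] at h
    simpa using h
  · change rowOp (annRow (wireA k) c) *ᵥ (basisState x₁ + basisState x₂) = 0
    rw [Matrix.mulVec_add, rowOp_annRow_mulVec_basisState _ _ (h₁ k),
      rowOp_annRow_mulVec_basisState _ _ (h₂ k), add_zero]

/-- The two halves `|c⁴⟩ ⊗ (|0⁴⟩ + |1⁴⟩)`, `c = 0, 1`. [folklore] -/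
def halfM : Fin 2 → QReg (2 * 4) → ℂ :=
  ![basisState (blockString 0) + basisState (blockString 2),
    basisState (blockString 1) + basisState (blockString 3)]

theorem halfM_isGaussianWith_four : ∀ j, IsGaussianWith 4 (halfM j) := by
  intro j
  fin_cases j
  · exact pair_isGaussianWith_four false _ _ (by decide) (by decide) (by decide)
  · exact pair_isGaussianWith_four true _ _ (by decide) (by decide) (by decide)

/-- **Sharp load-bearing threshold: four annihilators are not enough.** If the dictionary only asks
for FOUR linearly independent annihilating Majorana combinations (instead of the eight of a pure
spinor), `|M⟩^{⊗2}` is a combination of TWO dictionary vectors: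
`½ |0⁴⟩⊗(|0⁴⟩+|1⁴⟩) + ½ |1⁴⟩⊗(|0⁴⟩+|1⁴⟩)`, each half annihilated by the four block-`A` modes
`c_{k,X} ± i c_{k,Y}`, `k < 4`. With `gaussRankTwoCopies_oneTerm_free` the `m = 4` rank of `M⊗M` is
exactly `2`; any proof of the crux must use at least five of the eight rows. [folklore] -/
theorem gaussRankTwoCopies_false_with_four_annihilators :
    ¬ ∀ (a : Fin 2 → ℂ) (g : Fin 2 → QReg (2 * 4) → ℂ), (∀ i, IsGaussianWith 4 (g i)) →
        magicMPow 2 ≠ ∑ i, a i • g i := by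
  intro h
  refine h (fun _ => ((Real.sqrt 2 : ℂ)⁻¹) ^ 2) halfM halfM_isGaussianWith_four ?_
  rw [magicMPow_two_eq_sum, Fin.sum_univ_two, Fin.sum_univ_four, ← smul_add]
  congr 1
  simp only [halfM, Matrix.cons_val_zero, Matrix.cons_val_one]
  abel


end Annihilator

/-! ## §7 Targets (pre-emptive audit of the candidate first lemmas; no line picked yet, `stuck_stubs = []`)

Read as typed in `Ideator3Sketch.lean` (cards clifford-monoid-pencil / lagrangian-triple-rigidity /
borel-fixed-limit-planes) and in card annihilator-peeling (its Sketch is item evidence, not in the tree):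
* `StabiliserBlockDiagonal` — TRUE as typed. Mixed part: `c_a c_b (M⊗M) = (c_a M) ⊗ (c_b M)` lands in the
  odd⊗odd sector while in-block quadratics stay in even⊗even, and the 64 vectors `(c_a M) ⊗ (c_b M)` are independent
  BECAUSE `M` has trivial annihilator (§6 `magicM_annihilator_eq_zero` is exactly the needed input); in-block part:
  `Q(X_A)M = μM`, `Q(X_B)M = -μM` and `μ = 0` by `β`-skewness of `so(8)` (`β(M,M) = 2 ≠ 0`; `c_p` is `β`-symmetric for
  `C = XYXY…`, so `c_pc_q`, `p ≠ q`, is `β`-skew). No junk case: `X = 0` gives `0 = 0`.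
* `MutuallyAnnihilatingBound` (Lemma C, `≤ 5`) — TRUE as typed: `XᵢXⱼ = 0` (all `i, j`, squares included) makes
  `I = Σ im Xᵢ` isotropic for the DOT product on `ℂ⁸` (the CAR form), `Xᵢ ∈ Λ²I`, `dim Λ²I ≤ 6` with equality iff `I`
  Lagrangian, and then `Q(Λ²I) ⊂ ann(M)` would put the even vector `M` in the joint kernel `Λ⁰F ⊕ Λ¹F` of the
  `aᵢaⱼ`, i.e. `M ∈ ℂ|vac_I⟩` Gaussian — contradicting §6 `magicM_not_isGaussian` (now landed-grade). Panel numerics: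
  max 5 over > 3 000 Lagrangians. The hypothesis "all `i, j`" (not just `i ≠ j`) IS used (for `im Xᵢ ⊂ (im Xᵢ)^⊥`).
* `PairProductAnnihilates` — proved in the sketch. `NonTransversePairFree` / `TransverseTripleFreeAnn` — a partition
  of the crux (`crux_of_cases` kernel-checked); each is true iff its case of the crux is; no independent attack surface.
* `TopStratumFree`, `CutSimilitude` — `TopStratumFree` TRUE (panel re-derivations ×3); `CutSimilitude`'s sign
  `μ = -λ` was under kit j008398 (ideator) — only the typed dictionary depends on it.
* annihilator-peeling: `PeelGaussian` TRUE (Chevalley: `c(b)u_L`, `b` isotropic, is `0` or the pure spinor of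
  `ℂb ⊕ (L ∩ b^⊥)`); `AdmissibleAnnihilator` TRUE (an 8-dim isotropic `L` is inside neither 8-dim non-degenerate
  block, and `(a,0),(0,c) ∈ L ⇒ (a,c) ∈ L`); `PeeledRankBound` quantifies over ISOTROPIC admissible `b` only (checked:
  `Admissible := isotropic ∧ both blocks nonzero`) — the ten-orbit classification `1 E + 9 N` under `SL(4)² × ℂˣ` is
  complete on my re-derivation (`{ξ(x) = c ≠ 0}` is one `SL(4)`-orbit by the translations `ξ ↦ ξ - cφ`, `φ ∈ ann x`;
  null types x-only / ξ-only / mixed; `E`-type forces `E`-type on the other block since `ξ_A·x_A = -ξ_B·x_B`).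
  Its kit job j010690 ERRORED (rc 1, 3 s) — the effective constant `η₅₉` of its Transfer is unmeasured; the exact
  certificates (peel2.out, two primes) stand.
VERDICT: no candidate stub is false or mis-typed on my reading; the Lean-hard ones are vacuum uniqueness /
`AnnihilatorMaximal` (dim of the joint kernel of a Lagrangian = 1), Lemma C, and the peeling rank certificates
(59 × 59 minors over `ℤ[i]`). §6 supplies two of their inputs (trivial annihilator of `M` and of `M⊗M`;
`¬ IsGaussian M`) in importable form. -/

/-! ## §9 Attack ledger (cycle 1, 2026-08-16, refuter-cdisprove-stmt-QuantumAdvantage-1248-0)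

* Formalisation audit: faithful (QReg = Fin n → Bool; pauliString = Kronecker product; JW
  Majoranas with CAR; IsGauss = pure spinors of both parities, isotropy automatic; Mpow 2 = the
  four block-constant strings with amplitude 1/2, blocks contiguous in JW order). No junk model:
  `IsGaussian` is inhabited (basis states) and excludes `M⊗M` (annihilator dimension 0, checked
  numerically; `magicM` non-Gaussian is in the tree's review evidence). Nothing to misstate.
* Degenerate cases: none available (all parameters of the crux are fixed numerals).
* Load-bearing: §1 (both dictionary conditions are used by any proof); the "8 independent
  annihilators" could be weakened to 7 WITHOUT changing the statement (a 7-dimensional isotropic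
  annihilator leaves a 2-dim joint kernel `{w, f w}` whose even part is still a pure spinor) —
  information for the prover: the 8th row of `A` carries no weight for an even target.
* Tightness: §2 (four terms), and `r ↦ 1 - r/4` numerically (§3).
* Counterexample search: 4 284 LM restarts (node.js `js/gsearch.js strata`, 18 rounds × 20
  strata × 12; table in evidence file Numerics.md), all strata, residual floor 0.2500 (type-0o-containing strata: 0.5000 — the odd⊗odd
  product is useless, effectively two terms); E-sector-alone relaxation (`js/esector.js`, 2 rounds
  × 15 strata × 24): border solutions only (§4(6b)); kit jobs j007975 (smoke), j008152, j008157 (numpy, Spin(16,ℂ)-orbit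
  parametrisation, calibration on random σ₃ points, structured starts) queued on the farm —
  their summaries attach to the item automatically.
* Border-rank probes (`js/border.js`, exact parametrisation of the two boundary strata of σ̄₃ of a smooth variety —
  tangent-plus-point `span(T̂_{g₁}, g₂)` and osculating `span(T̂_g, X²g)`): the tangent-plus-point distance² also
  floors at 0.2500 (24 descent runs over type pairs (4,4),(4,0e),(0e,4),(0e,0e); none below 1/4); the osculating
  probe was not reached within this cycle's wall budget (next cycle). Together with the 1/4 floor of the 3-point
  search this is numerical evidence for BORDER rank 4 and for `DistBound 3 (1/4)`.
* Literature: the conjecture is open in print as of Reardon-Smith 2024 (arXiv:2407.20934, §5: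
  "little is known about the FLO rank of products of magic states; Cudby–Strelchuk is the state
  of the art"); FLO extent is multiplicative for 4-qubit parity eigenstates (ibid.), consistent
  with — not implying — rank 4.
* PAPER PROOF OF THE CRUX APPEARED DURING THIS CYCLE (crux-ideate card `isotropy-defect-rank-four`,
  planner-cruxidea-stmt-QuantumAdvantage-1248-2-0) and was CHECKED ADVERSARIALLY here (`js/isotropy.js`, item JW
  conventions, independent code): (F1) `dim span{c_pc_q (M⊗M)} = 78` ✓ (reproduced), (F2) `dim span{c_pc_q g} = 29`
  for every Gaussian tested ✓ (= `ℂg ⊕ Λ²L'·g`, normal ordering), (F3) `dim 𝔨·g` over the stabiliser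
  `𝔨 = spin(7)_A ⊕ spin(7)_B` (dim 21 + 21 ✓): 12 at `|0⁸⟩`, 11 at `|0011⟩|0101⟩`, 12/13 on other products, 19/24/27/21
  on the type-1/2/3/4 references, ≥ 12 on 36 random orbit points — and the closed-orbit argument gives `≥ 10` for ALL
  pure spinors (Δ₊(16)|_{Spin7²} = (1⊕7)⊠(1⊕7) ⊕ 8⊠8 is multiplicity-free; of its five highest-weight lines only
  `[h⊗h']` (orbit Q⁵×Q⁵, dim 10) and `[s⊗s']` (dim 12) are pure; boundary orbits have smaller dimension). The count
  `dim ker Ψ ≤ 3·29 − 78 = 9 < 10 ≤ rank θ` is airtight on my reading: every `X ∈ 𝔨` gives the relation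
  `Σ aᵢ X gᵢ = X(M⊗M) = 0` inside `T₁ × T₂ × T₃`, and `X ↦ aᵢ₀ X gᵢ₀` alone has rank ≥ 10. So `χ_G(M⊗M) = 4` is
  TRUE; no kill exists; the standing attack is moot for the EXACT-rank statement. What stays open (and adversarially
  live): the border/metric strengthening `DistBound 3 c` (card border-rank-four; my conjecture `c = 1/4`), and the
  strength of the Lean landing of (F3) (it needs `≥ 10`, the card states `11`).
* Verdict this cycle: RESISTS — indeed PROVED on paper (above); cdisprove found no misstatement and no counterexample. No kill; the natural strengthening `DistBound 3 (1/4)` also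
  resists. Recommended prover line: finish the isoclinic case analysis of §4(6) (pen-and-paper,
  then Lean over `Matrix (Fin 8) (Fin 8) ℂ`), or certify `M⊗M ∉ σ₃` numerically-exactly per
  stratum (each stratum is ≤ 3 copies of SO(8,ℂ) data — small enough for Gröbner after the
  normalisations of §4(5)).
-/

/-! ## §9b Attack ledger (cycle 2, 2026-08-16, refuter-cdisprove-stmt-QuantumAdvantage-1248-g2-0)

* State at re-arm: crux PROVED on paper by three independent complete arguments (cards lagrangian-triple-rigidity,
  isotropy-defect-rank-four, e8-cartan-quotient; border rank 4 by e8 and border-rank-four; a fourth exact proof,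
  annihilator-peeling, filed 02:32Z), each re-derived and numerically cross-checked by the three-triager panel
  (TRIAGE-r1-{1,2,3}: pass all, fail none). No line picked yet; no stuck stubs. A kill of the crux is off the table;
  this seat's job is now (i) kernel-checked NEGATIVE/SUPPORT lemmas the provers will need, (ii) attacks on the
  natural strengthenings, (iii) stub audits.
* (i) §6: trivial annihilator of `M⊗M` and of `M` (the (T1) input of every proof), `¬ IsGaussian (M⊗M)`,
  `¬ IsGaussian M`, the bit-flip engine `majorana_mulVec_basisState`, and the SHARP load-bearing threshold on the
  dictionary (4 rows: 2 terms suffice; 1 term never; 5–7 rows: implied) — all rc 0, no sorry, axioms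
  {propext, Classical.choice, Quot.sound}; def-free twins filed for landing under `Theorems/GaussRankTwoCopies/Negative/`
  (`MajoranaBitFlip.lean`, then `Annihilators.lean`).
* (ii) NUMERICS, independent numpy twin with a chart-exact Thouless/variable-projection LM parametrisation
  (`compute/gsearch.py`; every iterate is an exact pure-spinor `r`-tuple, re-charted to its largest amplitude after
  each step; planted-target calibration inside): kit j010861 (t = 2, r = 2,3; pre-registered floor `1 - r/4`),
  j010864 (t = 3, r = 7: the MULTIPLICATIVITY strengthening `χ_G(M^{⊗3}) = 8` — a residual → 0 would refute it and
  would be news for the route's thesis; pre-registered floor `1/8`), j010865 (t = 3, r = 4,5,6: metric profile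
  `1 - r/8`?). Results fold into §3 when the jobs return (summaries auto-attach to the item).
* (iii) §7: no candidate stub false or mis-typed.
* Verdict this cycle: RESISTS (indeed proved on paper ×4); no misstatement; strengthenings `DistBound 3 (1/4)` and
  multiplicativity at `t = 3` under numerical attack.
-/

end Summit.QuantumAdvantage.QuantumAdvantage.Cruxes.GaussRankTwoCopies.Disproof
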